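import Mathlib
import Summits.AtomisticToContinuum.HydrodynamicLimit.Theorems.InformationPercolationEngineKickFairRelEquilibriumMesoConditionThePastDefs
import Summits.AtomisticToContinuum.HydrodynamicLimit.Theorems.InformationPercolationEngineKickFairRelEquilibriumMesoReductionBSetup
import Summits.AtomisticToContinuum.HydrodynamicLimit.Theorems.InformationPercolationEngineKickFairRelEquilibriumMesoReductionB
import Literature.MathematicalPhysics.KineticTheory.LocalGibbsConstEquivalence
import HarnessLib

/-!
# `KickFairRelEquilibriumMeso`, line `condition-the-past` — Red-B″: the truncated fluctuation from the pair
# conditional covariance (`truncatedFluctuation_of_pairCondCov`)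

Prover file (`--supports stmt-AtomisticToContinuum-15177`, wave 2, lead c7) for the registered sub-goal
`truncatedFluctuation_of_pairCondCov : PairExpansion2 → PairCondCov rs → UnorderedPairWeight rs → TruncatedFluctuation rs`
(`…ConditionThePastDefs`, rev 2) of the line `condition-the-past` of the crux
`Summit.AtomisticToContinuum.HydrodynamicLimit.Theses.InformationPercolationEngine.KickFairRelEquilibriumMeso`.

It is the landed Red-B argument (`stub_reductionB`, `…MesoReductionB`, on top of the finite family of
`…MesoReductionBSetup`: `pastSA`/`wt`/`validEv`/`ordEv` over `Fin (N+1) × Fin (idxCut A N)` and the a.e. identification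
`truncSum_ae_eq`) with two changes.

* The enlarged σ-algebra of a pair is the JOIN `joinSA Φ r i n i' n'` of the two typed pasts (comap of the pair map
  `z ↦ (P_{i,n}, P_{i',n'})`); it contains both pasts (`pastSA_le_joinSA_left/right`), is Borel (`joinSA_le`) and
  makes both order events measurable (`measurableSet_ordEv_joinSA`, `…_swap_joinSA`, from `measurableSet_precedes`), and
  the ordered term of the abstract expansion PE″ (`PairExpansion2`) is then DEFINITIONALLY the pair conditional covariance
  `pairCondCovLG` of B2″ (`condExp_joinSA_eq`).
* Constants: PE″ gives `∫ S² ≤ 2X + 4B²Y` (`B = 2C`), so the B2″ target is `δ²/4` and the CT-b target `δ²/(32C²+1)`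
  (`two_targets_le_sq`).

Everything else is reused by name from the two landed Red-B files: under the local Gibbs law (a probability measure for
`σ ≤ 1/2`) apply PE″; Cauchy–Schwarz `(c ∫|S|)² ≤ c² ∫ S²` (`sq_integral_abs_le_integral_sq`); on the a.e. set where the
cut is genuine (`ae_forall_lt_cnt_iff_pastTime`) the ordered-pair sum `X` and the unordered-pair count `Y` of the truncated
family are dominated pointwise by the B2″ / CT-b integrands (`pairSum_ordered_abs_le`, `pairSum_unordered_le`), in the
`lintegral` currency (`integral_le_of_lintegral_ofReal_le`).
-/

noncomputable section

open MeasureTheory Set Filter Topology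
open scoped ENNReal Classical

namespace Summit.AtomisticToContinuum.HydrodynamicLimit.Theorems.KickFairRelEquilibriumMesoLine

open Literature.Analysis.FluidPDE Literature.MathematicalPhysics.KineticTheory

variable {σ : ℝ} {N : ℕ}

/-! ## The join σ-algebra of a pair of typed pasts -/

/-- The JOIN of the typed pasts of `(i, n)` and `(i', n')` (the `mA k l` of `PairExpansion2`): the comap σ-algebra of
the pair map `z ↦ (P_{i,n}(z), P_{i',n'}(z))` — literally the σ-algebra in the definition of `pairCondCovLG`. [folklore] -/
@[reducible] def joinSA (Φ : Flow σ N) (r : ℝ) (i : Fin (N + 1)) (n : ℕ) (i' : Fin (N + 1)) (n' : ℕ) :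
    MeasurableSpace (Phase N) :=
  MeasurableSpace.comap (fun z => (past Φ r z i n, past Φ r z i' n')) inferInstance

section Join

variable (Φ : Flow σ N) (r : ℝ)

/-- The pair map of two typed pasts is Borel measurable. [folklore] -/
theorem measurable_pastJoin (i : Fin (N + 1)) (n : ℕ) (i' : Fin (N + 1)) (n' : ℕ) :
    Measurable fun z : Phase N => (past Φ r z i n, past Φ r z i' n') :=
  (measurable_past Φ r i n).prodMk (measurable_past Φ r i' n')

/-- `mA k l ≤ m0`: the join is a sub-σ-algebra of the Borel one. [folklore] -/
theorem joinSA_le (i : Fin (N + 1)) (n : ℕ) (i' : Fin (N + 1)) (n' : ℕ) :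
    joinSA Φ r i n i' n' ≤ (inferInstance : MeasurableSpace (Phase N)) :=
  (measurable_pastJoin Φ r i n i' n').comap_le

/-- `m k ≤ mA k l`: the past of `k = (i,n)` is the first component of the pair map. [folklore] -/
theorem pastSA_le_joinSA_left (i : Fin (N + 1)) (n : ℕ) (i' : Fin (N + 1)) (n' : ℕ) :
    pastSA Φ r i n ≤ joinSA Φ r i n i' n' := by
  have h : (fun z => past Φ r z i n) =
      (fun t : Past N × Past N => t.1) ∘ (fun z : Phase N => (past Φ r z i n, past Φ r z i' n')) := rfl
  unfold pastSA joinSA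
  rw [h, ← MeasurableSpace.comap_comp]
  exact MeasurableSpace.comap_mono measurable_fst.comap_le

/-- `m l ≤ mA k l`: the past of `l = (i',n')` is the second component of the pair map. [folklore] -/
theorem pastSA_le_joinSA_right (i : Fin (N + 1)) (n : ℕ) (i' : Fin (N + 1)) (n' : ℕ) :
    pastSA Φ r i' n' ≤ joinSA Φ r i n i' n' := by
  have h : (fun z => past Φ r z i' n') =
      (fun t : Past N × Past N => t.2) ∘ (fun z : Phase N => (past Φ r z i n, past Φ r z i' n')) := rfl
  unfold pastSA joinSA
  rw [h, ← MeasurableSpace.comap_comp]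
  exact MeasurableSpace.comap_mono measurable_snd.comap_le

/-- `o k l` is an `mA k l`-event: `Precedes` is Borel in the pair of pasts (`measurableSet_precedes`). [folklore] -/
theorem measurableSet_ordEv_joinSA (i : Fin (N + 1)) (n : ℕ) (i' : Fin (N + 1)) (n' : ℕ) :
    MeasurableSet[joinSA Φ r i n i' n'] (ordEv Φ r i n i' n') := by
  have h : ordEv Φ r i n i' n' = (fun z : Phase N => (past Φ r z i n, past Φ r z i' n')) ⁻¹'
      {q : Past N × Past N | Precedes q.1 q.2} := rfl
  rw [h]
  exact comap_measurable _ (measurableSet_precedes N)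

/-- `o l k` is an `mA k l`-event as well (preimage under the swapped pair map). [folklore] -/
theorem measurableSet_ordEv_swap_joinSA (i : Fin (N + 1)) (n : ℕ) (i' : Fin (N + 1)) (n' : ℕ) :
    MeasurableSet[joinSA Φ r i n i' n'] (ordEv Φ r i' n' i n) := by
  have h : ordEv Φ r i' n' i n = (fun z : Phase N => (past Φ r z i n, past Φ r z i' n')) ⁻¹'
      ((fun t : Past N × Past N => (t.2, t.1)) ⁻¹' {q : Past N × Past N | Precedes q.1 q.2}) := rfl
  rw [h]
  exact comap_measurable _ ((measurableSet_precedes N).preimage (measurable_snd.prodMk measurable_fst))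

/-- The ordered term of `PairExpansion2` for the family is the line's `pairCondCovLG` (definitionally): the conditional
expectation, given the join, of the product of the two centred kicks. [folklore] -/
theorem condExp_joinSA_eq (a₀ θ₀ : T3 → ℝ) (u₀ : T3 → V3) (g : V3 × V3 × V3 → ℝ) (i : Fin (N + 1)) (n : ℕ)
    (i' : Fin (N + 1)) (n' : ℕ) :
    (localGibbsLaw σ a₀ u₀ θ₀ N Φ)[(fun z => (kickDev Φ r g i n z - betaLG σ a₀ θ₀ u₀ Φ r g i n z) *
        (kickDev Φ r g i' n' z - betaLG σ a₀ θ₀ u₀ Φ r g i' n' z)) | joinSA Φ r i n i' n'] =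
      pairCondCovLG σ a₀ θ₀ u₀ Φ r g i n i' n' := rfl

end Join

/-! ## The pair conditional covariance: measurability, a.e. bound, pointwise domination of the ordered sum -/

section CondCov

variable {a₀ θ₀ : T3 → ℝ} {u₀ : T3 → V3}

/-- `pairCondCovLG` is Borel measurable (a conditional expectation w.r.t. a sub-σ-algebra of the Borel one). [folklore] -/
theorem measurable_pairCondCovLG (Φ : Flow σ N) (r : ℝ) (g : V3 × V3 × V3 → ℝ) (i : Fin (N + 1)) (n : ℕ)
    (i' : Fin (N + 1)) (n' : ℕ) : Measurable (pairCondCovLG σ a₀ θ₀ u₀ Φ r g i n i' n') :=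
  (stronglyMeasurable_condExp.measurable).mono (joinSA_le Φ r i n i' n') le_rfl

/-- **`|Γ((i,n),(i',n'))| ≤ (4C)²` for all index pairs, `LG`-a.e.** (`|D − β| ≤ 4C` a.e., conditional expectation of an
a.e. bounded product). [folklore] -/
theorem ae_forall_abs_pairCondCovLG_le (hσ2 : σ ≤ 1 / 2) (Φ : Flow σ N) (r : ℝ) {g : V3 × V3 × V3 → ℝ} {C : ℝ}
    (hg : ∀ p, |g p| ≤ C) :
    ∀ᵐ z ∂(localGibbsLaw σ a₀ u₀ θ₀ N Φ), ∀ i : Fin (N + 1), ∀ n : ℕ, ∀ i' : Fin (N + 1), ∀ n' : ℕ,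
      |pairCondCovLG σ a₀ θ₀ u₀ Φ r g i n i' n' z| ≤ (4 * C) ^ 2 := by
  refine ae_all_iff.2 fun i => ae_all_iff.2 fun n => ae_all_iff.2 fun i' => ae_all_iff.2 fun n' =>
    ae_bdd_abs_condExp_of_ae_bdd_abs ?_
  filter_upwards [ae_forall_abs_kickDev_le (a₀ := a₀) (θ₀ := θ₀) (u₀ := u₀) hσ2 Φ r hg,
    ae_forall_abs_betaLG_le (a₀ := a₀) (θ₀ := θ₀) (u₀ := u₀) hσ2 Φ r hg] with z hD hβ
  have h1 : |kickDev Φ r g i n z - betaLG σ a₀ θ₀ u₀ Φ r g i n z| ≤ 4 * C :=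
    (abs_sub _ _).trans (by linarith [hD i n, hβ i n])
  have h2 : |kickDev Φ r g i' n' z - betaLG σ a₀ θ₀ u₀ Φ r g i' n' z| ≤ 4 * C :=
    (abs_sub _ _).trans (by linarith [hD i' n', hβ i' n'])
  rw [abs_mul, sq]
  exact mul_le_mul h1 h2 (abs_nonneg _) ((abs_nonneg _).trans h1)

/-- **Pointwise comparison, ordered pairs, for an arbitrary pair functional**: where the cut is genuine, the ordered-pair
sum over the truncated family `Fin (N+1) × Fin M` of `1_{v ∩ v ∩ o} |F|` is dominated by the full ordered pair sum
`Σ_i Σ_{n<cnt_i} Σ_{i'} Σ_{n'<cnt_{i'}} 1_≺ |F|` (drop the truncation; nonnegative terms). [folklore] -/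
theorem pairSum_ordered_abs_le (Φ : Flow σ N) (τ r : ℝ) (F : Fin (N + 1) → ℕ → Fin (N + 1) → ℕ → Phase N → ℝ)
    (M : ℕ) {z : Phase N}
    (hz : ∀ (i : Fin (N + 1)) (n : ℕ), n < cnt Φ τ z i ↔ (past Φ r z i n).2.2.2 ∈ Set.Ioc 0 τ) :
    ∑ k : Fin (N + 1) × Fin M, ∑ l : Fin (N + 1) × Fin M,
        (validEv Φ τ r k.1 k.2 ∩ validEv Φ τ r l.1 l.2 ∩ ordEv Φ r k.1 k.2 l.1 l.2).indicator
            (fun _ => (1 : ℝ)) z * |F k.1 k.2 l.1 l.2 z| ≤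
      ∑ i : Fin (N + 1), ∑ n ∈ Finset.range (cnt Φ τ z i),
        ∑ i' : Fin (N + 1), ∑ n' ∈ Finset.range (cnt Φ τ z i'),
          (if Precedes (past Φ r z i n) (past Φ r z i' n') then (1 : ℝ) else 0) * |F i n i' n' z| := by
  refine le_trans (le_of_eq (Fintype.sum_congr _ _ fun k => Fintype.sum_congr _ _ fun l => ?_))
    (sum_prod_fin_cut_le (cnt Φ τ z) M (fun i n i' n' =>
      (if Precedes (past Φ r z i n) (past Φ r z i' n') then (1 : ℝ) else 0) * |F i n i' n' z|)
        fun _ _ _ _ => by positivity)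
  by_cases hk : (past Φ r z k.1 k.2).2.2.2 ∈ Set.Ioc 0 τ <;>
    by_cases hl : (past Φ r z l.1 l.2).2.2.2 ∈ Set.Ioc 0 τ <;>
      by_cases hp : Precedes (past Φ r z k.1 k.2) (past Φ r z l.1 l.2) <;>
        simp only [validEv, ordEv, Set.indicator_apply, Set.mem_inter_iff, Set.mem_preimage, Set.mem_setOf_eq,
          hz, hk, hl, hp, and_true, and_false, and_self, if_true, if_false, one_mul, zero_mul]

/-- `2 (δ²/4) + 16C² δ²/(32C²+1) ≤ δ²` (the choice of the B2″ and CT-b targets). [folklore] -/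
theorem two_targets_le_sq (C δ : ℝ) :
    2 * (δ ^ 2 / 4) + 4 * (2 * C) ^ 2 * (δ ^ 2 / (32 * C ^ 2 + 1)) ≤ δ ^ 2 := by
  have h2 : 4 * (2 * C) ^ 2 * (δ ^ 2 / (32 * C ^ 2 + 1)) ≤ δ ^ 2 / 2 := by
    rw [← mul_div_assoc, div_le_div_iff₀ (by positivity) (by positivity)]; nlinarith [sq_nonneg δ, sq_nonneg C]
  linarith

end CondCov

/-! ## The registered sub-goal -/

section Main

variable {a₀ θ₀ : T3 → ℝ} {u₀ : T3 → V3}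

/-- **Red-B″ `truncatedFluctuation_of_pairCondCov` — the truncated fluctuation from the pair conditional covariance.**
From the abstract pair expansion on the join (PE″), the pair conditional covariance bound (B2″) and the unordered pair
count (CT-b), the truncated fluctuation bound (TF): instantiate PE″ on the finite family of `…MesoReductionBSetup` with the
JOIN σ-algebras `joinSA` under the local Gibbs law (a probability measure for `σ ≤ 1/2`) — its ordered term is literally
`|pairCondCovLG|` —, identify the truncated sum with the weighted centred family sum a.e. (`truncSum_ae_eq`), Cauchy–Schwarz,
and compare the two finite pair sums with the B2″ / CT-b integrands pointwise a.e. (nonnegative terms, genuine cut) in the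
`lintegral` currency. [folklore] -/
theorem truncatedFluctuation_of_pairCondCov :
    PairExpansion2 → PairCondCov rs → UnorderedPairWeight rs → TruncatedFluctuation rs := by
  intro hPE hB2 hCb a₀ θ₀ u₀ ha hθ hu ha0 hθ0
  obtain ⟨σ₁, hσ₁, H2⟩ := hB2 a₀ θ₀ u₀ ha hθ hu ha0 hθ0
  obtain ⟨σ₂, hσ₂, Hb⟩ := hCb a₀ θ₀ u₀ ha hθ hu ha0 hθ0
  refine ⟨min (min σ₁ σ₂) (1 / 2), lt_min (lt_min hσ₁ hσ₂) (by norm_num), ?_⟩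
  intro σ hσ hσlt Φ τ hτ g hg hgb A hA δ hδ
  obtain ⟨C, hC⟩ := hgb
  have hσ1' : σ < σ₁ := hσlt.trans_le ((min_le_left _ _).trans (min_le_left _ _))
  have hσ2' : σ < σ₂ := hσlt.trans_le ((min_le_left _ _).trans (min_le_right _ _))
  have hσ2 : σ ≤ 1 / 2 := (hσlt.trans_le (min_le_right _ _)).le
  have hC0 : 0 ≤ C := (abs_nonneg _).trans (hC 0)
  -- the targets for B2″ and CT-b
  set δ₂ : ℝ := δ ^ 2 / 4 with hδ₂
  set δb : ℝ := δ ^ 2 / (32 * C ^ 2 + 1) with hδb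
  have hδ₂0 : 0 < δ₂ := by positivity
  have hδb0 : 0 < δb := by positivity
  obtain ⟨N₁, hN₁⟩ := H2 σ hσ hσ1' Φ τ hτ g hg ⟨C, hC⟩ δ₂ hδ₂0
  obtain ⟨N₂, hN₂⟩ := Hb σ hσ hσ2' Φ τ hτ δb hδb0
  refine ⟨max N₁ N₂, fun N hN h hhm hhb => ?_⟩
  have hB2N := hN₁ N (le_of_max_le_left hN)
  have hCbN := hN₂ N (le_of_max_le_right hN)
  set LG := localGibbsLaw σ a₀ u₀ θ₀ N (Φ N) with hLG
  haveI : IsProbabilityMeasure LG := isProbabilityMeasure_localGibbsLaw ha hθ hu ha0 hθ0 hσ2 N (Φ N)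
  set c : ℝ := hsDiameter σ N / ((N : ℝ) + 1) with hc
  have hc0 : 0 ≤ c := div_nonneg (hsDiameter_pos hσ N).le (by positivity)
  set M : ℕ := idxCut A N with hM
  set r : ℝ := rs N with hr
  set β : Fin (N + 1) → ℕ → Phase N → ℝ := fun i n => betaLG σ a₀ θ₀ u₀ (Φ N) r g i n with hβ
  set Γ : Fin (N + 1) → ℕ → Fin (N + 1) → ℕ → Phase N → ℝ :=
    fun i n i' n' => pairCondCovLG σ a₀ θ₀ u₀ (Φ N) r g i n i' n' with hΓ
  set D : Fin (N + 1) → ℕ → Phase N → ℝ := fun i n => kickDev (Φ N) r g i n with hD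
  set w : Fin (N + 1) → ℕ → Phase N → ℝ := fun i n => wt (Φ N) τ r h i n with hw
  set Sf : Phase N → ℝ := fun z => ∑ k : Fin (N + 1) × Fin M, w k.1 k.2 z * (D k.1 k.2 z - β k.1 k.2 z) with hSf
  have haeD := ae_forall_abs_kickDev_le (a₀ := a₀) (θ₀ := θ₀) (u₀ := u₀) hσ2 (Φ N) r hC
  have haeβ := ae_forall_abs_betaLG_le (a₀ := a₀) (θ₀ := θ₀) (u₀ := u₀) hσ2 (Φ N) r hC
  have haeΓ := ae_forall_abs_pairCondCovLG_le (a₀ := a₀) (θ₀ := θ₀) (u₀ := u₀) hσ2 (Φ N) r hC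
  have haecut := ae_forall_lt_cnt_iff_pastTime (a₀ := a₀) (θ₀ := θ₀) (u₀ := u₀) hσ2 (Φ N) τ r
  -- Step 1: the abstract pair expansion PE″ for the family, on the joins
  have hPEapp : ∫ z, Sf z ^ 2 ∂LG ≤
      2 * ∑ k : Fin (N + 1) × Fin M, ∑ l : Fin (N + 1) × Fin M,
        (∫ z, (validEv (Φ N) τ r k.1 k.2 ∩ validEv (Φ N) τ r l.1 l.2 ∩ ordEv (Φ N) r k.1 k.2 l.1 l.2).indicator
            (fun _ => (1 : ℝ)) z * |Γ k.1 k.2 l.1 l.2 z| ∂LG) +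
      4 * (2 * C) ^ 2 * ∑ k : Fin (N + 1) × Fin M, ∑ l : Fin (N + 1) × Fin M,
        LG.real (validEv (Φ N) τ r k.1 k.2 ∩ validEv (Φ N) τ r l.1 l.2 ∩
          (ordEv (Φ N) r k.1 k.2 l.1 l.2)ᶜ ∩ (ordEv (Φ N) r l.1 l.2 k.1 k.2)ᶜ) :=
    hPE (Phase N) inferInstance LG (Fin (N + 1) × Fin M)
      (fun k => pastSA (Φ N) r k.1 k.2) (fun k l => joinSA (Φ N) r k.1 k.2 l.1 l.2)
      (fun k => D k.1 k.2) (fun k => w k.1 k.2) (fun k => validEv (Φ N) τ r k.1 k.2)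
      (fun k l => ordEv (Φ N) r k.1 k.2 l.1 l.2) (2 * C) (by positivity)
      (fun k => pastSA_le (Φ N) r k.1 k.2) (fun k l => joinSA_le (Φ N) r k.1 k.2 l.1 l.2)
      (fun k l => pastSA_le_joinSA_left (Φ N) r k.1 k.2 l.1 l.2)
      (fun k l => pastSA_le_joinSA_right (Φ N) r k.1 k.2 l.1 l.2)
      (fun k => integrable_of_ae_abs_le (measurable_kickDev (Φ N) r hg k.1 k.2).aestronglyMeasurable
        (haeD.mono fun z hz => hz k.1 k.2))
      (fun k => haeD.mono fun z hz => hz k.1 k.2)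
      (fun k => stronglyMeasurable_wt (Φ N) r τ hhm k.1 k.2)
      (fun k => measurableSet_validEv (Φ N) r τ k.1 k.2)
      (fun k z => abs_wt_le (Φ N) r τ hhb k.1 k.2 z)
      (fun k l => measurableSet_ordEv_joinSA (Φ N) r k.1 k.2 l.1 l.2)
      (fun k l => measurableSet_ordEv_swap_joinSA (Φ N) r k.1 k.2 l.1 l.2)
  set X : ℝ := ∑ k : Fin (N + 1) × Fin M, ∑ l : Fin (N + 1) × Fin M,
        (∫ z, (validEv (Φ N) τ r k.1 k.2 ∩ validEv (Φ N) τ r l.1 l.2 ∩ ordEv (Φ N) r k.1 k.2 l.1 l.2).indicator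
            (fun _ => (1 : ℝ)) z * |Γ k.1 k.2 l.1 l.2 z| ∂LG) with hX
  set Y : ℝ := ∑ k : Fin (N + 1) × Fin M, ∑ l : Fin (N + 1) × Fin M,
        LG.real (validEv (Φ N) τ r k.1 k.2 ∩ validEv (Φ N) τ r l.1 l.2 ∩
          (ordEv (Φ N) r k.1 k.2 l.1 l.2)ᶜ ∩ (ordEv (Φ N) r l.1 l.2 k.1 k.2)ᶜ) with hY
  -- Step 2: integrability of the family sum
  have hSfm : Measurable Sf := Finset.measurable_sum _ fun k _ => (measurable_wt (Φ N) τ r hhm k.1 k.2).mul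
    ((measurable_kickDev (Φ N) r hg k.1 k.2).sub (measurable_betaLG_borel (Φ N) r g k.1 k.2))
  have hSfb : ∀ᵐ z ∂LG, |Sf z| ≤ ∑ _k : Fin (N + 1) × Fin M, 4 * C := by
    filter_upwards [haeD, haeβ] with z hDz hβz
    refine (Finset.abs_sum_le_sum_abs _ _).trans (Finset.sum_le_sum fun k _ => ?_)
    rw [abs_mul]
    calc |w k.1 k.2 z| * |D k.1 k.2 z - β k.1 k.2 z| ≤ 1 * (2 * C + 2 * C) :=
          mul_le_mul (abs_wt_le_one (Φ N) τ r hhb k.1 k.2 z)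
            ((abs_sub _ _).trans (add_le_add (hDz k.1 k.2) (hβz k.1 k.2))) (abs_nonneg _) zero_le_one
      _ = 4 * C := by ring
  have hSfi : Integrable Sf LG := integrable_of_ae_abs_le hSfm.aestronglyMeasurable hSfb
  have hSf2i : Integrable (fun z => Sf z ^ 2) LG := by
    refine integrable_of_ae_abs_le (hSfm.pow_const 2).aestronglyMeasurable
      (B := (∑ _k : Fin (N + 1) × Fin M, 4 * C) ^ 2) (hSfb.mono fun z hz => ?_)
    rw [abs_pow]
    exact pow_le_pow_left₀ (abs_nonneg _) hz 2
  -- Step 3: the ordered pairs, `c² X ≤ δ₂` (B2″)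
  have hSm : ∀ k l : Fin (N + 1) × Fin M, MeasurableSet
      (validEv (Φ N) τ r k.1 k.2 ∩ validEv (Φ N) τ r l.1 l.2 ∩ ordEv (Φ N) r k.1 k.2 l.1 l.2) := fun k l =>
    ((measurableSet_validEv_borel (Φ N) τ r k.1 k.2).inter (measurableSet_validEv_borel (Φ N) τ r l.1 l.2)).inter
      (measurableSet_ordEv_borel (Φ N) r hg k.1 k.2 l.1 l.2)
  have hTi : ∀ k l : Fin (N + 1) × Fin M, Integrable (fun z =>
      (validEv (Φ N) τ r k.1 k.2 ∩ validEv (Φ N) τ r l.1 l.2 ∩ ordEv (Φ N) r k.1 k.2 l.1 l.2).indicator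
        (fun _ => (1 : ℝ)) z * |Γ k.1 k.2 l.1 l.2 z|) LG := by
    intro k l
    refine integrable_of_ae_abs_le (((measurable_const.indicator (hSm k l)).mul
      (measurable_pairCondCovLG (Φ N) r g k.1 k.2 l.1 l.2).abs).aestronglyMeasurable) (B := 1 * (4 * C) ^ 2) ?_
    filter_upwards [haeΓ] with z h1
    rw [abs_mul, abs_abs, abs_of_nonneg (Set.indicator_nonneg (fun _ _ => zero_le_one) _)]
    exact mul_le_mul (Set.indicator_le_self' (fun _ _ => zero_le_one) z) (h1 k.1 k.2 l.1 l.2) (abs_nonneg _)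
      zero_le_one
  have hXb : c ^ 2 * X ≤ δ₂ := by
    have hFi : Integrable (fun z => c ^ 2 * ∑ k : Fin (N + 1) × Fin M, ∑ l : Fin (N + 1) × Fin M,
        (validEv (Φ N) τ r k.1 k.2 ∩ validEv (Φ N) τ r l.1 l.2 ∩ ordEv (Φ N) r k.1 k.2 l.1 l.2).indicator
          (fun _ => (1 : ℝ)) z * |Γ k.1 k.2 l.1 l.2 z|) LG :=
      (integrable_finsetSum _ fun k _ => integrable_finsetSum _ fun l _ => hTi k l).const_mul _
    have hXeq : c ^ 2 * X = ∫ z, c ^ 2 * ∑ k : Fin (N + 1) × Fin M, ∑ l : Fin (N + 1) × Fin M,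
        (validEv (Φ N) τ r k.1 k.2 ∩ validEv (Φ N) τ r l.1 l.2 ∩ ordEv (Φ N) r k.1 k.2 l.1 l.2).indicator
          (fun _ => (1 : ℝ)) z * |Γ k.1 k.2 l.1 l.2 z| ∂LG := by
      rw [integral_const_mul, integral_finsetSum _ fun k _ => integrable_finsetSum _ fun l _ => hTi k l, hX]
      exact congrArg _ (Finset.sum_congr rfl fun k _ => (integral_finsetSum _ fun l _ => hTi k l).symm)
    rw [hXeq]
    refine integral_le_of_lintegral_ofReal_le (ae_of_all _ fun z => ?_) hFi.aestronglyMeasurable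
      (haecut.mono fun z hz => ?_) hB2N hδ₂0.le
    · exact mul_nonneg (sq_nonneg _) (Finset.sum_nonneg fun k _ => Finset.sum_nonneg fun l _ =>
        mul_nonneg (Set.indicator_nonneg (fun _ _ => zero_le_one) _) (abs_nonneg _))
    · exact mul_le_mul_of_nonneg_left (pairSum_ordered_abs_le (Φ N) τ r Γ M hz) (sq_nonneg _)
  -- Step 4: the unordered pairs, `c² Y ≤ δb` (CT-b)
  have hS'm : ∀ k l : Fin (N + 1) × Fin M, MeasurableSet (validEv (Φ N) τ r k.1 k.2 ∩ validEv (Φ N) τ r l.1 l.2 ∩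
      (ordEv (Φ N) r k.1 k.2 l.1 l.2)ᶜ ∩ (ordEv (Φ N) r l.1 l.2 k.1 k.2)ᶜ) := fun k l =>
    (((measurableSet_validEv_borel (Φ N) τ r k.1 k.2).inter (measurableSet_validEv_borel (Φ N) τ r l.1 l.2)).inter
      (measurableSet_ordEv_borel (Φ N) r hg k.1 k.2 l.1 l.2).compl).inter
        (measurableSet_ordEv_borel (Φ N) r hg l.1 l.2 k.1 k.2).compl
  have hT'i : ∀ k l : Fin (N + 1) × Fin M, Integrable (fun z => (validEv (Φ N) τ r k.1 k.2 ∩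
      validEv (Φ N) τ r l.1 l.2 ∩ (ordEv (Φ N) r k.1 k.2 l.1 l.2)ᶜ ∩ (ordEv (Φ N) r l.1 l.2 k.1 k.2)ᶜ).indicator
        (fun _ => (1 : ℝ)) z) LG := fun k l => (integrable_const _).indicator (hS'm k l)
  have hYb : c ^ 2 * Y ≤ δb := by
    have hFi : Integrable (fun z => c ^ 2 * ∑ k : Fin (N + 1) × Fin M, ∑ l : Fin (N + 1) × Fin M,
        (validEv (Φ N) τ r k.1 k.2 ∩ validEv (Φ N) τ r l.1 l.2 ∩ (ordEv (Φ N) r k.1 k.2 l.1 l.2)ᶜ ∩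
          (ordEv (Φ N) r l.1 l.2 k.1 k.2)ᶜ).indicator (fun _ => (1 : ℝ)) z) LG :=
      (integrable_finsetSum _ fun k _ => integrable_finsetSum _ fun l _ => hT'i k l).const_mul _
    have hYeq : c ^ 2 * Y = ∫ z, c ^ 2 * ∑ k : Fin (N + 1) × Fin M, ∑ l : Fin (N + 1) × Fin M,
        (validEv (Φ N) τ r k.1 k.2 ∩ validEv (Φ N) τ r l.1 l.2 ∩ (ordEv (Φ N) r k.1 k.2 l.1 l.2)ᶜ ∩
          (ordEv (Φ N) r l.1 l.2 k.1 k.2)ᶜ).indicator (fun _ => (1 : ℝ)) z ∂LG := by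
      rw [integral_const_mul, integral_finsetSum _ fun k _ => integrable_finsetSum _ fun l _ => hT'i k l, hY]
      refine congrArg _ (Finset.sum_congr rfl fun k _ => ?_)
      rw [integral_finsetSum _ fun l _ => hT'i k l]
      exact Finset.sum_congr rfl fun l _ => by rw [integral_indicator_const _ (hS'm k l), smul_eq_mul, mul_one]
    rw [hYeq]
    refine integral_le_of_lintegral_ofReal_le (ae_of_all _ fun z => ?_) hFi.aestronglyMeasurable
      (haecut.mono fun z hz => ?_) hCbN hδb0.le
    · exact mul_nonneg (sq_nonneg _) (Finset.sum_nonneg fun k _ => Finset.sum_nonneg fun l _ =>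
        Set.indicator_nonneg (fun _ _ => zero_le_one) _)
    · exact mul_le_mul_of_nonneg_left (pairSum_unordered_le (Φ N) τ r M hz) (sq_nonneg _)
  -- Step 5: Cauchy–Schwarz and the conclusion `c ∫ |Sf| ≤ δ`
  have hI0 : 0 ≤ ∫ z, |Sf z| ∂LG := integral_nonneg fun z => abs_nonneg _
  have hmain : c * ∫ z, |Sf z| ∂LG ≤ δ := by
    refine (pow_le_pow_iff_left₀ (mul_nonneg hc0 hI0) hδ.le two_ne_zero).1 ?_
    calc (c * ∫ z, |Sf z| ∂LG) ^ 2 = c ^ 2 * (∫ z, |Sf z| ∂LG) ^ 2 := by ring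
      _ ≤ c ^ 2 * ∫ z, Sf z ^ 2 ∂LG :=
          mul_le_mul_of_nonneg_left (sq_integral_abs_le_integral_sq hSfi hSf2i) (sq_nonneg _)
      _ ≤ c ^ 2 * (2 * X + 4 * (2 * C) ^ 2 * Y) := mul_le_mul_of_nonneg_left hPEapp (sq_nonneg _)
      _ = 2 * (c ^ 2 * X) + 4 * (2 * C) ^ 2 * (c ^ 2 * Y) := by ring
      _ ≤ 2 * δ₂ + 4 * (2 * C) ^ 2 * δb :=
          add_le_add (mul_le_mul_of_nonneg_left hXb (by positivity)) (mul_le_mul_of_nonneg_left hYb (by positivity))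
      _ ≤ δ ^ 2 := two_targets_le_sq C δ
  -- Step 6: back to the `lintegral` statement through `truncSum_ae_eq`
  have hcI : Integrable (fun z => c * |Sf z|) LG := hSfi.abs.const_mul c
  refine (lintegral_congr_ae (g := fun z => ENNReal.ofReal (c * |Sf z|)) ?_).trans_le ?_
  · filter_upwards [truncSum_ae_eq σ N a₀ θ₀ u₀ hσ2 (Φ N) τ r g A h] with z hz
    rw [hz, abs_mul, abs_of_nonneg hc0]
  · show ∫⁻ z, ENNReal.ofReal (c * |Sf z|) ∂LG ≤ ENNReal.ofReal δ
    rw [← ofReal_integral_eq_lintegral_ofReal hcI (ae_of_all _ fun z => mul_nonneg hc0 (abs_nonneg _))]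
    refine ENNReal.ofReal_le_ofReal ?_
    rw [integral_const_mul]
    exact hmain

end Main

end Summit.AtomisticToContinuum.HydrodynamicLimit.Theorems.KickFairRelEquilibriumMesoLine

end
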